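import Literature.AlgebraicGeometry.HodgeTheory.FermatHodgeConjectureAokiProofs
import Literature.AlgebraicGeometry.HodgeTheory.FermatClaimShiodaSpine
import Literature.AlgebraicGeometry.HodgeTheory.FermatInductiveClaimsProofs
import HarnessLib

/-!
# Stub `stub_printedSupply` (S3b) of line `cancel-by-any-claim-lattice`, crux `HodgeFermatVarieties` (stmt-HodgeConjecture-1334)

The printed supply `Supply[M]` of level `M` — pairs `{a, -a}` (`a ≠ 0`), Hodge multisets with `4`
elements (Fermat surface), semi-decomposable Hodge sextuples, and Aoki's standard elements
`σ_{p,a} = {a + j d : j < p} + {-p a}` (`p` an odd prime dividing `M`, `d = M/p`,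
`2 < d/(⟨a⟩, d)`) — consists of non-empty Hodge multisets `u` with `claim(u)` and `claim(-u)`,
GRANTED: Aoki 1987 Thm 1-1 (`Shioda_claim_paired`, not even needed: pairs live in dimension `0`),
Aoki–Shioda 1983 (2.1) (`AokiShioda1983_eigenline_le_neronSeveri`), Aoki 1987 Thm 2-1
(`Aoki1987_claim_pStandard`), the type-II supply (statement of stub S3a) and level change
(statement of stub S2). ARITHMETIC ONLY. Pairs: `ClaimMultiset.pair`; Hodge 4-multisets:
`ClaimMultiset.surface_of_claim_one`; sextuples: S3a; standard elements: PRIMITIVE ones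
(`(⟨a⟩, d) = 1`) are Hodge by `Aoki1987.isHodge_pStandard` and claimed by Thm 2-1; IMPRIMITIVE ones
(`(⟨a⟩, d) = g > 1`) are `g •` the primitive `σ_{p,a/g}` of level `M/g` (`levelRaise_std`), raised
by S2. Negations: `-{a,-a} = {-a, a}`, `-`(Hodge) is Hodge (`isHodgeMultiset_map_neg`: `⟨t(-a)⟩ =
⟨(-t)a⟩` and `-t` is a unit), `-`(semi) is semi, and `-σ_{p,a} = σ_{p,-a}` (`std_map_neg`:
reindex `j ↦ (p-1)j mod p`; `(⟨-a⟩, d) = (⟨a⟩, d)` as `d ∣ M`).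

References: N. Aoki, Some new algebraic cycles on Fermat varieties, J. Math. Soc. Japan 39 (1987),
Thm 1-1, §1 p. 387 (`σ_{p,i}`), Thm 2-1; N. Aoki, T. Shioda, Generators of the Néron–Severi group
of a Fermat surface (1983) (2.1); T. Shioda, Proc. Japan Acad. 55A (1979) §1 Def. (iii).
-/

set_option linter.dupNamespace false

noncomputable section

open CategoryTheory AlgebraicGeometry Finset
open Literature.AlgebraicGeometry Literature.AlgebraicGeometry.Motives
open Literature.AlgebraicGeometry.HodgeTheory Literature.AlgebraicGeometry.HodgeTheory.FermatCharacter
open Literature.AlgebraicTopology.SingularHomology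

namespace Summit.HodgeConjecture.HodgeConjecture.Theorems.CancelByAnyClaimLattice

/-- `Supply[M]` — the printed supply of level `M` (local notation of the line, verbatim). -/
local notation3 (prettyPrint := false) "Supply[" M "]" =>
  ({s : Multiset (ZMod M) | ∃ a : ZMod M, a ≠ 0 ∧ s = ({a, -a} : Multiset (ZMod M))} ∪
    {s : Multiset (ZMod M) | IsHodgeMultiset s ∧ Multiset.card s = 4} ∪
    {s : Multiset (ZMod M) | IsHodgeMultiset s ∧ IsSemiDecomposable s} ∪
    {s : Multiset (ZMod M) | ∃ (p : ℕ) (a : ZMod M), p.Prime ∧ p ≠ 2 ∧ p ∣ M ∧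
        2 < (M / p) / Nat.gcd (ZMod.val a) (M / p) ∧
        s = Multiset.map (fun j : ℕ => a + (j : ZMod M) * ((M / p : ℕ) : ZMod M)) (Multiset.range p) +
              {-((p : ZMod M) * a)}} : Set (Multiset (ZMod M)))

/-- `LevelRaise[k, m, s]` — level raising `s ↦ k • s` (local notation of the line, verbatim). -/
local notation3 (prettyPrint := false) "LevelRaise[" k ", " m ", " s "]" =>
  Multiset.map (fun a : ZMod m => ((k * ZMod.val a : ℕ) : ZMod (k * m))) s

/-- `Std[N, p, b]` — the standard multiset `σ_{p,b} = {b + j d : j < p} + {-p b}` of level `N`,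
`d = N/p` (local notation of this file; the fourth summand of `Supply[N]` verbatim). -/
local notation3 (prettyPrint := false) "Std[" N ", " p ", " b "]" =>
  Multiset.map (fun j : ℕ => b + (j : ZMod N) * ((N / p : ℕ) : ZMod N)) (Multiset.range p) +
    {-((p : ZMod N) * b)}

/-! ### Negation bookkeeping -/

/-- The negation of a Hodge multiset is a Hodge multiset: `-a ≠ 0`, `Σ(-a) = 0`, and
`⟨t · (-a)⟩ = ⟨(-t) · a⟩` with `-t` again a unit. [cite: Shioda1979PJA, §1 (definition of `Mₘ`)] -/
private theorem isHodgeMultiset_map_neg {M : ℕ} {s : Multiset (ZMod M)} (hs : IsHodgeMultiset s) :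
    IsHodgeMultiset (s.map fun a ↦ -a) := by
  refine ⟨⟨fun a ha ↦ ?_, ?_⟩, fun t ↦ ?_⟩
  · obtain ⟨b, hb, rfl⟩ := Multiset.mem_map.1 ha
    exact neg_ne_zero.2 (hs.1.1 b hb)
  · rw [Multiset.sum_map_neg', hs.1.2, neg_zero]
  · have hf : ((fun a ↦ (t : ZMod M) * a) ∘ fun a ↦ -a) = fun a ↦ ((-t : (ZMod M)ˣ) : ZMod M) * a := by
      funext a
      simp [Units.val_neg]
    rw [Multiset.map_map, Multiset.card_map, hf]
    exact hs.2 (-t)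

/-- The negation of a semi-decomposable multiset is semi-decomposable (negate both triples).
[cite: Shioda1979PJA, §1 Definition (iii)] -/
private theorem isSemiDecomposable_map_neg {M : ℕ} {s : Multiset (ZMod M)}
    (hs : IsSemiDecomposable s) : IsSemiDecomposable (s.map fun a ↦ -a) := by
  obtain ⟨t, u, ht, hu, hts, hus, rfl⟩ := hs
  refine ⟨t.map (fun a ↦ -a), u.map (fun a ↦ -a), by rw [Multiset.card_map, ht],
    by rw [Multiset.card_map, hu], ?_, ?_, by rw [Multiset.map_add]⟩
  · rw [Multiset.sum_map_neg', hts, neg_zero]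
  · rw [Multiset.sum_map_neg', hus, neg_zero]

/-- `(⟨-a⟩, d) = (⟨a⟩, d)` for `d ∣ M` (`⟨-a⟩ = M - ⟨a⟩` or `a = 0`). [folklore] -/
private theorem gcd_val_neg {M d : ℕ} [NeZero M] (hdM : d ∣ M) (a : ZMod M) :
    Nat.gcd (-a).val d = Nat.gcd a.val d := by
  by_cases ha : a = 0
  · simp [ha]
  rw [ZMod.neg_val, if_neg ha]
  have hle : a.val ≤ M := (ZMod.val_lt a).le
  apply Nat.dvd_antisymm
  · refine Nat.dvd_gcd ?_ (Nat.gcd_dvd_right _ _)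
    have h1 : Nat.gcd (M - a.val) d ∣ M := (Nat.gcd_dvd_right _ _).trans hdM
    have h2 : Nat.gcd (M - a.val) d ∣ M - (M - a.val) := Nat.dvd_sub h1 (Nat.gcd_dvd_left _ _)
    rwa [Nat.sub_sub_self hle] at h2
  · refine Nat.dvd_gcd ?_ (Nat.gcd_dvd_right _ _)
    exact Nat.dvd_sub ((Nat.gcd_dvd_right _ _).trans hdM) (Nat.gcd_dvd_left _ _)

/-! ### Reindexing the arithmetic progression of a standard element -/

/-- Reindexing `Multiset.range p` by an affine bijection `k ↦ (c + u k) mod p`, `(u, p) = 1`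
(multiset form of `Aoki1987.sum_range_affine_mod`). [folklore] -/
private theorem range_map_affine {X : Type*} (p c u : ℕ) (hp : 0 < p) (hu : Nat.Coprime u p)
    (f : ℕ → X) :
    (Multiset.range p).map (fun k ↦ f ((c + u * k) % p)) = (Multiset.range p).map f := by
  have key : ∀ g : ℕ → X, (Multiset.range p).map g = ∑ k ∈ Finset.range p, ({g k} : Multiset X) := by
    intro g
    rw [Finset.sum_eq_multiset_sum, Finset.range_val,
      ← Multiset.sum_map_singleton ((Multiset.range p).map g), Multiset.map_map]
    rfl
  rw [key, key f]
  exact Aoki1987.sum_range_affine_mod p c u hp hu (fun k ↦ ({f k} : Multiset X))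

/-- **`-σ_{p,a} = σ_{p,-a}` as multisets**: `-(a + j d) = -a + ((p-1) j mod p) d` since `p d = M = 0`,
and `-(-(p a)) = -(p (-a))`. [cite: Aoki1987, §1 p. 387 (σ_{p,i})] -/
private theorem std_map_neg {M p : ℕ} (hp : p.Prime) (hpM : p ∣ M) (a : ZMod M) :
    (Std[M, p, a]).map (fun x ↦ -x) = Std[M, p, -a] := by
  have hpd : (p : ZMod M) * ((M / p : ℕ) : ZMod M) = 0 := by
    rw [← Nat.cast_mul, Nat.mul_div_cancel' hpM, ZMod.natCast_self]
  have hu : Nat.Coprime (p - 1) p :=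
    (Nat.coprime_self_sub_left hp.one_le).2 (Nat.coprime_one_left p)
  rw [Multiset.map_add, Multiset.map_singleton, Multiset.map_map]
  congr 1
  · rw [← range_map_affine p 0 (p - 1) hp.pos hu
      (fun j : ℕ ↦ -a + (j : ZMod M) * ((M / p : ℕ) : ZMod M))]
    refine Multiset.map_congr rfl fun k _ ↦ ?_
    simp only [Function.comp_apply, zero_add]
    have h1 : (((p - 1) * k % p : ℕ) : ZMod M) + (p : ZMod M) * ((p - 1) * k / p : ℕ) =
        ((p : ZMod M) - 1) * k := by
      have h := congrArg (Nat.cast : ℕ → ZMod M) (Nat.mod_add_div ((p - 1) * k) p)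
      simp only [Nat.cast_add, Nat.cast_mul, Nat.cast_pred hp.pos] at h
      exact h
    linear_combination (-((M / p : ℕ) : ZMod M)) * h1 +
      ((((p - 1) * k / p : ℕ) : ZMod M) - k) * hpd
  · simp

/-! ### Level raising of a primitive standard element -/

/-- `g · ⟨n mod m⟩ ≡ g n (mod g m)`. [folklore] -/
private theorem raise_natCast (g m n : ℕ) :
    ((g * (n : ZMod m).val : ℕ) : ZMod (g * m)) = ((g * n : ℕ) : ZMod (g * m)) := by
  rw [ZMod.val_natCast, ← Nat.mul_mod_mul_left, ZMod.natCast_mod]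

/-- `g · ⟨-x⟩ ≡ -(g ⟨x⟩) (mod g m)`. [folklore] -/
private theorem raise_neg (g m : ℕ) [NeZero m] (x : ZMod m) :
    ((g * (-x).val : ℕ) : ZMod (g * m)) = -((g * x.val : ℕ) : ZMod (g * m)) := by
  by_cases hx : x = 0
  · subst hx
    simp
  rw [ZMod.neg_val, if_neg hx, Nat.mul_sub, Nat.cast_sub (Nat.mul_le_mul_left g (ZMod.val_lt x).le),
    ZMod.natCast_self, zero_sub]

/-- **`σ_{p, g a₀}` of level `g M'` is `g •` the standard element `σ_{p,a₀}` of level `M' = p d'`**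
(entrywise `g ⟨a₀ + j d'⟩_{M'} ≡ g a₀ + j (g d')`, `g ⟨-p a₀⟩_{M'} ≡ -p (g a₀)` modulo `g M'`).
[cite: Aoki1987, §1 p. 387 (σ_{p,i} with (i, d) > 1)] -/
private theorem levelRaise_std (g p d' a₀ : ℕ) (hp : 0 < p) [NeZero (p * d')] :
    LevelRaise[g, p * d', Std[p * d', p, ((a₀ : ℕ) : ZMod (p * d'))]] =
      Std[g * (p * d'), p, ((g * a₀ : ℕ) : ZMod (g * (p * d')))] := by
  have hdiv : g * (p * d') / p = g * d' := by
    rw [Nat.mul_left_comm, Nat.mul_div_cancel_left _ hp]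
  rw [Nat.mul_div_cancel_left d' hp, hdiv, Multiset.map_add, Multiset.map_map, Multiset.map_singleton]
  congr 1
  · refine Multiset.map_congr rfl fun j _ ↦ ?_
    simp only [Function.comp_apply]
    rw [show (a₀ : ZMod (p * d')) + (j : ZMod (p * d')) * ((d' : ℕ) : ZMod (p * d')) =
        ((a₀ + j * d' : ℕ) : ZMod (p * d')) by push_cast; ring, raise_natCast]
    push_cast
    ring
  · rw [show (p : ZMod (p * d')) * (a₀ : ZMod (p * d')) = ((p * a₀ : ℕ) : ZMod (p * d')) by
        push_cast; ring, raise_neg, raise_natCast]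
    congr 1
    push_cast
    ring

/-! ### Standard elements: non-empty, Hodge, claimed -/

/-- A standard multiset has `p + 1 > 0` elements. [folklore] -/
private theorem std_ne_zero {N p : ℕ} (b : ZMod N) : Std[N, p, b] ≠ 0 := by
  intro h
  have := congrArg Multiset.card h
  simp at this

/-- **Primitive standard elements** (`(⟨b⟩, d) = 1`, `d = N/p > 2`, `p` an odd prime dividing `N`):
Hodge by `Aoki1987.isHodge_pStandard` and claimed by Thm 2-1 (`Aoki1987_claim_pStandard`), through
any character `σ : Fin (2r+2) → ℤ/N`, `p = 2r + 1`, with value multiset `σ_{p,b}`.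
[cite: Aoki1987, §1 p. 387 (σ_{p,i} ∈ 𝔅) and Thm 2-1 (p. 388)] -/
private theorem std_primitive (hS : Aoki1987_claim_pStandard) (N p : ℕ) [NeZero N] (b : ZMod N)
    (hp : p.Prime) (hp2 : p ≠ 2) (hpN : p ∣ N) (hd : 2 < N / p) (hcop : Nat.Coprime b.val (N / p)) :
    IsHodgeMultiset (Std[N, p, b]) ∧ ClaimMultiset N (Std[N, p, b]) := by
  obtain ⟨r, hpr⟩ : Odd p := hp.eq_two_or_odd'.resolve_left hp2
  have hcard : Multiset.card (Std[N, p, b]) = 2 * r + 2 := by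
    rw [Multiset.card_add, Multiset.card_map, Multiset.card_range, Multiset.card_singleton]
    omega
  obtain ⟨σ, hσ⟩ := exists_eq_univ_val_map_of_card _ hcard
  refine ⟨?_, ?_⟩
  · rw [← hσ]
    exact (Aoki1987.isHodge_pStandard hp hpr hpN hd hcop hσ).isHodgeMultiset
  · rw [← hσ]
    exact (claimMultiset_univ_val_map_iff σ).2 (hS N p r hp hpr hpN hd b hcop σ hσ)

/-- **Every standard element of the supply is a non-empty claimed Hodge multiset**, granted Thm 2-1
and level change: with `d = M/p`, `g = (⟨a⟩, d)`, write `d = g d'`, `⟨a⟩ = g a₀`, `M = g (p d')`;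
then `σ_{p,a} = g • σ_{p,a₀}` with `σ_{p,a₀}` the PRIMITIVE standard element of level `p d'`
(`(a₀, d') = 1`, `d' > 2`), which is Hodge and claimed (`std_primitive`); level raising by `g`
(the antecedent S2) transports both to level `M`.
[cite: Aoki1987, §1 p. 387 (σ_{p,i}, d/(i,d) > 2), Thm 2-1 and Cor. 2-3 (p. 388)] -/
private theorem std_supply (hS : Aoki1987_claim_pStandard)
    (h2 : ∀ (m k : ℕ) [NeZero m], 0 < k → ∀ s : Multiset (ZMod m), s ≠ 0 → IsHodgeMultiset s →
      IsHodgeMultiset (LevelRaise[k, m, s]) ∧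
        (ClaimMultiset m s ↔ ClaimMultiset (k * m) (LevelRaise[k, m, s])))
    (M : ℕ) [NeZero M] (p : ℕ) (a : ZMod M) (hp : p.Prime) (hp2 : p ≠ 2) (hpM : p ∣ M)
    (hd : 2 < (M / p) / Nat.gcd (ZMod.val a) (M / p)) :
    Std[M, p, a] ≠ 0 ∧ IsHodgeMultiset (Std[M, p, a]) ∧ ClaimMultiset M (Std[M, p, a]) := by
  obtain ⟨g, hg⟩ : ∃ g : ℕ, Nat.gcd a.val (M / p) = g := ⟨_, rfl⟩
  have hg0 : 0 < g := Nat.pos_of_ne_zero (by rintro rfl; rw [hg, Nat.div_zero] at hd; omega)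
  have hcop : Nat.Coprime (a.val / g) (M / p / g) := by
    have h := Nat.coprime_div_gcd_div_gcd (m := a.val) (n := M / p) (by rw [hg]; exact hg0)
    rwa [hg] at h
  have hgd : g ∣ M / p := hg ▸ Nat.gcd_dvd_right _ _
  have hga : g ∣ a.val := hg ▸ Nat.gcd_dvd_left _ _
  rw [hg] at hd
  obtain ⟨d', hd'⟩ := hgd
  obtain ⟨a₀, ha₀⟩ := hga
  rw [hd', Nat.mul_div_cancel_left _ hg0] at hd hcop
  rw [ha₀, Nat.mul_div_cancel_left _ hg0] at hcop
  have hM : M = g * (p * d') := by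
    have h := Nat.mul_div_cancel' hpM
    rw [hd'] at h
    rw [← h]
    ring
  have ha₀lt : a₀ < p * d' := by
    have h := ZMod.val_lt a
    rw [ha₀, hM] at h
    exact Nat.lt_of_mul_lt_mul_left h
  have ha : a = ((g * a₀ : ℕ) : ZMod M) := by rw [← ha₀, ZMod.natCast_zmod_val]
  clear hg ha₀ hd'
  subst ha
  subst hM
  -- everything now lives at level `g * (p * d')`; the primitive element lives at level `p * d'`
  haveI : NeZero (p * d') := ⟨Nat.mul_ne_zero hp.ne_zero (by omega)⟩
  have hdiv : p * d' / p = d' := Nat.mul_div_cancel_left d' hp.pos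
  have hva : ((a₀ : ℕ) : ZMod (p * d')).val = a₀ := by
    rw [ZMod.val_natCast, Nat.mod_eq_of_lt ha₀lt]
  obtain ⟨hH', hC'⟩ := std_primitive hS (p * d') p ((a₀ : ℕ) : ZMod (p * d')) hp hp2
    (dvd_mul_right p d') (by rw [hdiv]; exact hd) (by rw [hva, hdiv]; exact hcop)
  obtain ⟨hH, hC⟩ := h2 (p * d') g hg0 (Std[p * d', p, ((a₀ : ℕ) : ZMod (p * d'))])
    (std_ne_zero _) hH'
  rw [levelRaise_std g p d' a₀ hp.pos] at hH hC
  exact ⟨std_ne_zero _, hH, hC.1 hC'⟩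

/-! ### The stub -/

/-- **S3b `stub_printedSupply` — the printed supply consists of non-empty claimed Hodge multisets,
closed under negation** (ARITHMETIC ONLY given its antecedents). Granted Thm 1-1
(`Shioda_claim_paired` — unused: pairs live in dimension `0`, `ClaimMultiset.pair`), Aoki–Shioda
1983 (2.1) (`AokiShioda1983_eigenline_le_neronSeveri`, fed to `ClaimMultiset.surface_of_claim_one`),
Thm 2-1 (`Aoki1987_claim_pStandard`), the type-II supply (statement of S3a) and level change
(statement of S2): every `u ∈ Supply[M]` is a non-empty Hodge multiset with `claim(u)` and
`claim(-u)`. Pairs: `IsHodgeMultiset.pair`, `ClaimMultiset.pair`, `-{a,-a} = {-a, a}`. Hodge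
4-multisets: the surface fact, `-u` again a Hodge 4-multiset. Sextuples: S3a, `-u` again a
semi-decomposable Hodge sextuple. Standard elements `σ_{p,a}`: `std_supply` (primitive: Thm 2-1 and
`Aoki1987.isHodge_pStandard`; imprimitive: `g •` a primitive one of level `M/g`, raised by S2), and
`-σ_{p,a} = σ_{p,-a}` (`std_map_neg`) with `(⟨-a⟩, d) = (⟨a⟩, d)` (`gcd_val_neg`).
[cite: Aoki1987, Thm 1-1 (p. 386), §1 p. 387 (σ_{p,i}), Thm 2-1 and Cor. 2-3 (p. 388)]
[cite: AokiShioda1983, §2 (2.1)] [cite: Shioda1979PJA, §1 Definition (iii) and §4] -/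
theorem stub_printedSupply :
    Shioda_claim_paired → AokiShioda1983_eigenline_le_neronSeveri → Aoki1987_claim_pStandard →
    (∀ (M : ℕ) [NeZero M] (s : Multiset (ZMod M)), IsHodgeMultiset s → IsSemiDecomposable s →
      ClaimMultiset M s) →
    (∀ (m k : ℕ) [NeZero m], 0 < k → ∀ s : Multiset (ZMod m), s ≠ 0 → IsHodgeMultiset s →
      IsHodgeMultiset (LevelRaise[k, m, s]) ∧
        (ClaimMultiset m s ↔ ClaimMultiset (k * m) (LevelRaise[k, m, s]))) →
    ∀ (M : ℕ) [NeZero M], ∀ u ∈ Supply[M],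
      u ≠ 0 ∧ IsHodgeMultiset u ∧ ClaimMultiset M u ∧ ClaimMultiset M (u.map fun a ↦ -a) := by
  intro _ hNS hS h3a h2 M _ u hu
  simp only [Set.mem_union, Set.mem_setOf_eq] at hu
  rcases hu with ((⟨a, ha, rfl⟩ | ⟨hu, h4⟩) | ⟨hu, hsemi⟩) | ⟨p, a, hp, hp2, hpM, hd, rfl⟩
  · -- pairs `{a, -a}`: dimension `0`
    have hneg : ({a, -a} : Multiset (ZMod M)).map (fun x ↦ -x) = {-a, -(-a)} := by
      simp [Multiset.insert_eq_cons]
    refine ⟨by simp [Multiset.insert_eq_cons], IsHodgeMultiset.pair ha, ClaimMultiset.pair a, ?_⟩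
    rw [hneg]
    exact ClaimMultiset.pair (-a)
  · -- Hodge multisets with `4` elements: the Fermat surface
    have h1 : ∀ α : Fin (2 * 1 + 2) → ZMod M, IsHodge α → Claim M 1 α := fun α hα ↦ hNS M α hα
    have h4' : Multiset.card (u.map fun x ↦ -x) = 4 := by rw [Multiset.card_map, h4]
    refine ⟨?_, hu, ClaimMultiset.surface_of_claim_one h1 hu h4,
      ClaimMultiset.surface_of_claim_one h1 (isHodgeMultiset_map_neg hu) h4'⟩
    rintro rfl
    simp at h4
  · -- semi-decomposable Hodge sextuples: the type-II supply (S3a)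
    refine ⟨?_, hu, h3a M u hu hsemi,
      h3a M _ (isHodgeMultiset_map_neg hu) (isSemiDecomposable_map_neg hsemi)⟩
    obtain ⟨t, v, ht, -, -, -, rfl⟩ := hsemi
    intro h0
    have := congrArg Multiset.card h0
    rw [Multiset.card_add, ht] at this
    simp at this
  · -- standard elements `σ_{p,a}` and `-σ_{p,a} = σ_{p,-a}`
    obtain ⟨hne, hH, hC⟩ := std_supply hS h2 M p a hp hp2 hpM hd
    refine ⟨hne, hH, hC, ?_⟩
    rw [std_map_neg hp hpM a]
    have hd' : 2 < (M / p) / Nat.gcd (ZMod.val (-a)) (M / p) := by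
      rwa [gcd_val_neg (Nat.div_dvd_of_dvd hpM) a]
    exact (std_supply hS h2 M p (-a) hp hp2 hpM hd').2.2

end Summit.HodgeConjecture.HodgeConjecture.Theorems.CancelByAnyClaimLattice

end
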